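import Literature.Topology.FourManifolds.ZeroSphereSurgeryModel
import HarnessLib

/-!
# The local model of the `0`-surgery along a framed `S⁰`, II: the neck piece, the model
# gluing `(S² × S¹) ∖ pt = (ℝ³ ∖ {0, q}) ∪ neck`, and the remaining model maps

Topic `Literature/Topology/FourManifolds`.  Sequel of `ZeroSphereSurgeryModel.lean` (the circle
parametrisations `cirP`, `cirP'`, the radial profile `profB` and the partial diffeomorphism
`modelH : ℝ³ ∖ 0 ⇀ S² × S¹`), second file of the proof of *"`0`-surgery along an orientably
framed `S⁰` in a connected `3`-manifold `Z` gives `Z # (S² × S¹)"* (A. Kosinski, *Differential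
Manifolds* (1993), VI §9 with VI (3.1), (6.6); J. Milnor, *Lectures on the h-cobordism theorem*
(1965), Def. 3.11, Thm. 3.13; R. C. Kirby, *The topology of 4-manifolds* (1989), Ch. I §2, p. 8).
This file collects ALL remaining definitions of the proof (so that the later files are pure
theorem files) and proves the model gluing:

* §4 `modelNeck`: the neck `(τ, u) ↦ (u, P' (32 τ/(32 - τ²)))`, typed on the ambient type
  `NeckAmbient = DiscreteIndex Unit × (ℝ¹ × S²)` of the tree's new piece `ballTimesSphere Unit 0 2`
  (`SphereFamilySurgery.lean`), a globally defined partial diffeomorphism with algebraic inverse;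
* §5 the gluing identities `H ((t/4) u) = neck (t, u)`, `H ((8/t) u) = neck (-t, u)` and the
  analysis of `H x = neck b`;
* §6 **`isOpenGluingWith_model` / `isOpenGluing_model`**: `(S² × S¹) ∖ {H q}` (`pieceP`,
  `q = (3/2) e₀`) is the open gluing of `ℝ³ ∖ {0, q}` (`pieceA`) and the neck along Milnor's
  identification `modelRel` for the framed `S⁰ = {0, ∞}` of `ℝ³ ∪ ∞` framed by the ball
  `t u ↦ (t/4) u` and the inverted ball `t u ↦ (8/t) u` — *"`S² × S¹` minus a point is the
  `0`-surgery of `S³ = ℝ³ ∪ ∞` along `{0, ∞}`"*;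
* §7 the Möbius inversion `mobN x = (x - q)/‖x - q‖²` and its inverse `mobM z = q + z/‖z‖²`
  (carrying `0 ↦ ∞ ↦ q`, `N 0 = -q/‖q‖² ↦ 0`);
* §8 the blow-up `blowUp = radialMap blowProfile : B(0, 1/8) ≅ ℝ³` of the chart ball of the
  `3`-manifold and its inverse `blowDown` (profile linear near `0`, `= 8 s/(1 - 8 s)` on
  `[1/22, 1/8)`);
* §9 the two standard framing discs `discNear`, `discFar : ℝ³ → ℝ³` in chart coordinates
  (`β̂⁻¹ ∘ N ∘ (x ↦ x/4)` and `β̂⁻¹ ∘ (N ∘ inv₈)`, `N ∘ inv₈ = farMob` in closed form, both made total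
  by the compression `fourBall`), the model map `modelK = H ∘ M ∘ β̂` on the chart ball and the
  connected-sum disc `discC2 y = H (q + g y / 2)` of `S² × S¹`;
* §10 the radius profile `lamProfile` of the separating neck of the assembly (`omegaProfile`, the
  odd extension of the tree's `ballProfile`);
* §11 Milnor's relation `stdRel D₊ D₋` for two prescribed discs of a `3`-manifold, and the open
  pieces `chartPieceY`, `blowPieceZ`.

The properties of §§7–10 beyond the algebraic identities recorded here are proved in the sequel
files.  No named facts are introduced.

## References

* A. A. Kosinski, *Differential Manifolds*, Academic Press (1993), VI §9, VI (3.1), (6.6).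
  [Kosinski1993]
* J. Milnor, *Lectures on the h-cobordism theorem* (1965), Def. 3.11, Thm. 3.13.
  [MilnorHCobordism1965]
* R. C. Kirby, *The topology of 4-manifolds*, LNM 1374 (1989), Ch. I §2, p. 8. [Kirby1989]
-/

open scoped Manifold ContDiff Topology
open Set Function Metric

noncomputable section

namespace Literature.Topology.FourManifolds

namespace ZeroSphereModel

open GluckUnknot (sphereProj coe_sphereProj sphereProj_smul_coe contDiffOn_normalize)

/-! ### §4 The neck piece `(-1, 1) × S² → S² × S¹`, `(τ, u) ↦ (u, P' (32τ/(32 - τ²)))` -/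

/-- The ambient type `Unit × (ℝ¹ × S²)` of the tree's new piece `ballTimesSphere Unit 0 2` of a
`0`-surgery in dimension `3` (`SphereFamilySurgery.lean`). [folklore] -/
abbrev NeckAmbient : Type := DiscreteIndex Unit × ((EuclideanSpace ℝ (Fin 1)) × (Metric.sphere (0 : EuclideanSpace ℝ (Fin 3)) 1))

/-- The unit vector of `ℝ¹`. [folklore] -/
def e1 : EuclideanSpace ℝ (Fin 1) := EuclideanSpace.single 0 1

/-- `e1 0 = 1`. [folklore] -/
@[simp] theorem e1_apply_zero : e1 0 = 1 := by simp [e1]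

/-- A vector of `ℝ¹` is its coordinate times `e1`. [folklore] -/
theorem eq_smul_e1 (v : EuclideanSpace ℝ (Fin 1)) : v = v 0 • e1 := by
  ext i
  fin_cases i
  simp [e1]

/-- The norm of a vector of `ℝ¹` is the absolute value of its coordinate. [folklore] -/
theorem norm_one_dim (v : EuclideanSpace ℝ (Fin 1)) : ‖v‖ = |v 0| := by
  rw [EuclideanSpace.norm_eq, Fin.sum_univ_one, Real.sqrt_sq_eq_abs, Real.norm_eq_abs, abs_abs]

/-- `‖c • e1‖ = |c|`. [folklore] -/
theorem norm_smul_e1 (c : ℝ) : ‖c • e1‖ = |c| := by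
  rw [norm_one_dim]; simp

/-- The neck reparametrisation `g τ = 32 τ/(32 - τ²)` of the interval `(-1, 1)`. [folklore] -/
def gτ (τ : ℝ) : ℝ := 32 * τ / (32 - τ ^ 2)

/-- Its inverse `g⁻¹ y = 32 y/(16 + √(256 + 32 y²))`. [folklore] -/
def gInv (y : ℝ) : ℝ := 32 * y / (16 + Real.sqrt (256 + 32 * y ^ 2))

/-- `√(256 + 32 (g τ)²) = 16 (32 + τ²)/(32 - τ²)` for `τ² < 32`. [folklore] -/
theorem sqrt_gτ {τ : ℝ} (hτ : τ ^ 2 < 32) :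
    Real.sqrt (256 + 32 * gτ τ ^ 2) = 16 * (32 + τ ^ 2) / (32 - τ ^ 2) := by
  have hne : 32 - τ ^ 2 ≠ 0 := by linarith
  have hpos : 0 ≤ 16 * (32 + τ ^ 2) / (32 - τ ^ 2) := by
    apply div_nonneg <;> nlinarith [sq_nonneg τ]
  rw [← Real.sqrt_sq hpos]
  congr 1
  rw [gτ]
  field_simp
  ring

/-- `g⁻¹ (g τ) = τ` for `τ² < 32`. [folklore] -/
theorem gInv_gτ {τ : ℝ} (hτ : τ ^ 2 < 32) : gInv (gτ τ) = τ := by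
  have hne : 32 - τ ^ 2 ≠ 0 := by linarith
  rw [gInv, sqrt_gτ hτ, gτ]
  have h2 : (16 : ℝ) + 16 * (32 + τ ^ 2) / (32 - τ ^ 2) = 1024 / (32 - τ ^ 2) := by
    field_simp; ring
  rw [h2]
  field_simp
  ring

/-- `32 - (g⁻¹ y)² = 1024/(16 + √(256 + 32 y²))`. [folklore] -/
theorem sub_gInv_sq (y : ℝ) :
    32 - gInv y ^ 2 = 1024 / (16 + Real.sqrt (256 + 32 * y ^ 2)) := by
  set R := Real.sqrt (256 + 32 * y ^ 2) with hR
  have hR2 : R ^ 2 = 256 + 32 * y ^ 2 := Real.sq_sqrt (by positivity)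
  have hRpos : 0 ≤ R := Real.sqrt_nonneg _
  have hne : 16 + R ≠ 0 := by positivity
  rw [gInv, ← hR]
  field_simp
  nlinarith [hR2]

/-- `g (g⁻¹ y) = y`. [folklore] -/
theorem gτ_gInv (y : ℝ) : gτ (gInv y) = y := by
  rw [gτ, sub_gInv_sq, gInv]
  have hne : 16 + Real.sqrt (256 + 32 * y ^ 2) ≠ 0 := by positivity
  field_simp
  ring

/-- `(g⁻¹ y)² < 1` when `y² < (32/31)²`. [folklore] -/
theorem gInv_sq_lt_one {y : ℝ} (hy : y ^ 2 < 1024 / 961) : gInv y ^ 2 < 1 := by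
  set R := Real.sqrt (256 + 32 * y ^ 2) with hR
  have hR2 : R ^ 2 = 256 + 32 * y ^ 2 := Real.sq_sqrt (by positivity)
  have hRpos : 0 ≤ R := Real.sqrt_nonneg _
  have h32 := sub_gInv_sq y
  rw [← hR] at h32
  -- `32 - τ² = 1024/(16 + R) > 31` iff `R < 512/31 - 16`, iff `R² < …`
  have hlt : 1024 / (16 + R) > 31 := by
    rw [gt_iff_lt, lt_div_iff₀ (by positivity)]
    nlinarith [hR2, hy]
  linarith

/-- `(g τ)² < (32/31)²` for `|τ| < 1`. [folklore] -/
theorem gτ_sq_lt {τ : ℝ} (hτ : |τ| < 1) : gτ τ ^ 2 < 1024 / 961 := by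
  have hτ2 : τ ^ 2 < 1 := (sq_lt_one_iff_abs_lt_one τ).2 hτ
  have hden : 31 < 32 - τ ^ 2 := by linarith
  have h1 : |gτ τ| < 32 / 31 := by
    rw [gτ, abs_div, abs_of_pos (by linarith : (0 : ℝ) < 32 - τ ^ 2), abs_mul,
      abs_of_pos (by norm_num : (0 : ℝ) < 32), div_lt_div_iff₀ (by linarith) (by norm_num)]
    nlinarith [abs_nonneg τ]
  have h2 : 0 ≤ |gτ τ| := abs_nonneg _
  calc gτ τ ^ 2 = |gτ τ| ^ 2 := (sq_abs _).symm
    _ < (32 / 31) ^ 2 := by gcongr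
    _ = 1024 / 961 := by norm_num

/-- `(P' y)₀ > -63/1985` iff `y² < (32/31)²`. [folklore] -/
theorem cirB_apply_zero_gt_iff (y : ℝ) : -63 / 1985 < cirB y 0 ↔ y ^ 2 < 1024 / 961 := by
  rw [cirB_apply_zero, lt_div_iff₀ (by positivity)]
  constructor <;> intro h <;> nlinarith [h]

/-- On the unit circle off `(-1, 0)`, `(T p)² = (1 - p₀)/(1 + p₀)`. [folklore] -/
theorem cirT_sq {p : EuclideanSpace ℝ (Fin 2)} (hp : ‖p‖ = 1) (hp0 : p 0 ≠ -1) : cirT p ^ 2 = (1 - p 0) / (1 + p 0) := by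
  have h1 : p 0 ^ 2 + p 1 ^ 2 = 1 := by rw [← StdCircleSurgery.norm_sq_two, hp, one_pow]
  have hne : 1 + p 0 ≠ 0 := fun h => hp0 (by linarith)
  rw [cirT, div_pow, div_eq_div_iff (pow_ne_zero 2 hne) hne]
  nlinarith [h1]

/-- **The neck map** `(i, τ e1, u) ↦ (u, P' (g τ))` on `Unit × ℝ¹ × S²`. [cite: MilnorHCobordism1965, Def. 3.11] -/
def neckFun (b : NeckAmbient) : (Metric.sphere (0 : EuclideanSpace ℝ (Fin 3)) 1) × (Metric.sphere (0 : EuclideanSpace ℝ (Fin 2)) 1) := (b.2.2, cirP' (gτ (b.2.1 0)))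

/-- Its inverse `(u, p) ↦ ((), g⁻¹ (T p) • e1, u)`. [folklore] -/
def neckInv (w : (Metric.sphere (0 : EuclideanSpace ℝ (Fin 3)) 1) × (Metric.sphere (0 : EuclideanSpace ℝ (Fin 2)) 1)) : NeckAmbient :=
  (DiscreteIndex.mk (), (gInv (cirT (w.2 : EuclideanSpace ℝ (Fin 2))) • e1, w.1))

/-- First component of the neck map. [folklore] -/
@[simp] theorem neckFun_fst (b : NeckAmbient) : (neckFun b).1 = b.2.2 := rfl

/-- Second component of the neck map. [folklore] -/
@[simp] theorem neckFun_snd (b : NeckAmbient) : (neckFun b).2 = cirP' (gτ (b.2.1 0)) := rfl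

/-- `neckInv (neckFun b) = b` when `‖τ‖ < 1`. [folklore] -/
theorem neckInv_neckFun {b : NeckAmbient} (hb : ‖b.2.1‖ < 1) : neckInv (neckFun b) = b := by
  have hτ : |b.2.1 0| < 1 := by rwa [norm_one_dim] at hb
  have hτ2 : b.2.1 0 ^ 2 < 32 := by
    have := (sq_lt_one_iff_abs_lt_one _).2 hτ; linarith
  obtain ⟨i, v, u⟩ := b
  simp only [neckInv, neckFun_snd, neckFun_fst, coe_cirP', cirT_cirB, gInv_gτ hτ2]
  refine Prod.ext rfl (Prod.ext ?_ rfl)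
  exact (eq_smul_e1 v).symm

/-- `neckFun (neckInv w) = w` when `w₂ ≠ (-1, 0)`. [folklore] -/
theorem neckFun_neckInv {w : (Metric.sphere (0 : EuclideanSpace ℝ (Fin 3)) 1) × (Metric.sphere (0 : EuclideanSpace ℝ (Fin 2)) 1)} (hw : (w.2 : EuclideanSpace ℝ (Fin 2)) 0 ≠ -1) : neckFun (neckInv w) = w := by
  refine Prod.ext rfl ?_
  apply Subtype.ext
  simp only [neckFun_snd, neckInv, coe_cirP']
  rw [show (gInv (cirT (w.2 : EuclideanSpace ℝ (Fin 2))) • e1) 0 = gInv (cirT (w.2 : EuclideanSpace ℝ (Fin 2))) by simp, gτ_gInv,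
    cirB_cirT (norm_eq_of_mem_sphere w.2) hw]

/-- The neck map takes the open unit neck into `{w | w₂,₀ > -63/1985}`. [folklore] -/
theorem neckFun_snd_apply_zero_gt {b : NeckAmbient} (hb : ‖b.2.1‖ < 1) :
    -63 / 1985 < ((neckFun b).2 : EuclideanSpace ℝ (Fin 2)) 0 := by
  have hτ : |b.2.1 0| < 1 := by rwa [norm_one_dim] at hb
  rw [neckFun_snd, coe_cirP', cirB_apply_zero_gt_iff]
  exact gτ_sq_lt hτ

/-- The inverse neck map takes `{w | w₂,₀ > -63/1985}` into the open unit neck. [folklore] -/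
theorem norm_neckInv_lt {w : (Metric.sphere (0 : EuclideanSpace ℝ (Fin 3)) 1) × (Metric.sphere (0 : EuclideanSpace ℝ (Fin 2)) 1)} (hw : -63 / 1985 < (w.2 : EuclideanSpace ℝ (Fin 2)) 0) :
    ‖(neckInv w).2.1‖ < 1 := by
  have hw1 : (w.2 : EuclideanSpace ℝ (Fin 2)) 0 ≠ -1 := by intro h; rw [h] at hw; norm_num at hw
  have hne : 1 + (w.2 : EuclideanSpace ℝ (Fin 2)) 0 ≠ 0 := fun h => hw1 (by linarith)
  show ‖gInv (cirT (w.2 : EuclideanSpace ℝ (Fin 2))) • e1‖ < 1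
  rw [norm_smul_e1, ← sq_lt_one_iff_abs_lt_one]
  apply gInv_sq_lt_one
  have hpos : 0 < 1 + (w.2 : EuclideanSpace ℝ (Fin 2)) 0 := by linarith
  rw [cirT_sq (norm_eq_of_mem_sphere w.2) hw1, div_lt_div_iff₀ hpos (by norm_num)]
  nlinarith [hw]

/-- `g` is smooth where `τ² ≠ 32`. [folklore] -/
theorem contDiffAt_gτ {τ : ℝ} (hτ : τ ^ 2 ≠ 32) : ContDiffAt ℝ ∞ gτ τ := by
  have h : ContDiffAt ℝ ∞ (fun τ : ℝ => 32 * τ / (32 - τ ^ 2)) τ :=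
    (contDiffAt_const.mul contDiffAt_id).div (contDiffAt_const.sub (contDiffAt_id.pow 2))
      (sub_ne_zero.2 (Ne.symm hτ))
  exact h

/-- `g⁻¹` is smooth. [folklore] -/
theorem contDiff_gInv : ContDiff ℝ ∞ gInv := by
  refine (contDiff_const.mul contDiff_id).div (contDiff_const.add ?_) fun y => by positivity
  exact (contDiff_const.add (contDiff_const.mul (contDiff_id.pow 2))).sqrt fun y => by positivity

/-- The neck map is smooth on the open unit neck. [folklore] -/
theorem contMDiffOn_neckFun :
    ContMDiffOn ((𝓡 0).prod ((𝓡 1).prod (𝓡 2))) ((𝓡 2).prod (𝓡 1)) ∞ neckFun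
      {b : NeckAmbient | ‖b.2.1‖ < 1} := by
  refine (contMDiff_snd.comp contMDiff_snd).contMDiffOn.prodMk ?_
  have hτ : ContMDiff ((𝓡 0).prod ((𝓡 1).prod (𝓡 2))) 𝓘(ℝ, ℝ) ∞ fun b : NeckAmbient => b.2.1 0 :=
    ((EuclideanSpace.proj (0 : Fin 1) : EuclideanSpace ℝ (Fin 1) →L[ℝ] ℝ).contDiff.contMDiff).comp
      (contMDiff_fst.comp contMDiff_snd)
  have hg : ContMDiffOn ((𝓡 0).prod ((𝓡 1).prod (𝓡 2))) 𝓘(ℝ, ℝ) ∞ (fun b : NeckAmbient => gτ (b.2.1 0))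
      {b : NeckAmbient | ‖b.2.1‖ < 1} := by
    intro b hb
    have hτ1 : |b.2.1 0| < 1 := by rw [← norm_one_dim]; exact hb
    have hτ2 : b.2.1 0 ^ 2 ≠ 32 := by
      have := (sq_lt_one_iff_abs_lt_one _).2 hτ1; linarith
    exact ((contDiffAt_gτ hτ2).contMDiffAt).comp_contMDiffWithinAt b (hτ b).contMDiffWithinAt
  exact contMDiff_cirP'.comp_contMDiffOn hg

/-- The set `{w | w₂,₀ > -63/1985}` is open. [folklore] -/
theorem isOpen_neckTarget : IsOpen {w : (Metric.sphere (0 : EuclideanSpace ℝ (Fin 3)) 1) × (Metric.sphere (0 : EuclideanSpace ℝ (Fin 2)) 1) | -63 / 1985 < (w.2 : EuclideanSpace ℝ (Fin 2)) 0} := by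
  have hc : Continuous fun w : (Metric.sphere (0 : EuclideanSpace ℝ (Fin 3)) 1) × (Metric.sphere (0 : EuclideanSpace ℝ (Fin 2)) 1) => (w.2 : EuclideanSpace ℝ (Fin 2)) 0 :=
    (EuclideanSpace.proj (0 : Fin 2) : EuclideanSpace ℝ (Fin 2) →L[ℝ] ℝ).continuous.comp
      (continuous_subtype_val.comp continuous_snd)
  exact isOpen_lt continuous_const hc

/-- The inverse neck map is smooth on `{w | w₂,₀ > -63/1985}`. [folklore] -/
theorem contMDiffOn_neckInv :
    ContMDiffOn ((𝓡 2).prod (𝓡 1)) ((𝓡 0).prod ((𝓡 1).prod (𝓡 2))) ∞ neckInv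
      {w : (Metric.sphere (0 : EuclideanSpace ℝ (Fin 3)) 1) × (Metric.sphere (0 : EuclideanSpace ℝ (Fin 2)) 1) | -63 / 1985 < (w.2 : EuclideanSpace ℝ (Fin 2)) 0} := by
  haveI : Fact (Module.finrank ℝ (EuclideanSpace ℝ (Fin 2)) = 1 + 1) := ⟨by simp⟩
  haveI : Fact (Module.finrank ℝ (EuclideanSpace ℝ (Fin 3)) = 2 + 1) := ⟨by simp⟩
  refine contMDiff_const.contMDiffOn.prodMk (ContMDiffOn.prodMk ?_ (contMDiff_coe_sphere.comp
    contMDiff_fst |>.codRestrict_sphere fun w => w.1.2).contMDiffOn)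
  · have h2 : ContMDiff ((𝓡 2).prod (𝓡 1)) 𝓘(ℝ, EuclideanSpace ℝ (Fin 2)) ∞ fun w : (Metric.sphere (0 : EuclideanSpace ℝ (Fin 3)) 1) × (Metric.sphere (0 : EuclideanSpace ℝ (Fin 2)) 1) => (w.2 : EuclideanSpace ℝ (Fin 2)) :=
      contMDiff_coe_sphere.comp contMDiff_snd
    have h3 : ContMDiffOn ((𝓡 2).prod (𝓡 1)) 𝓘(ℝ, ℝ) ∞
        (fun w : (Metric.sphere (0 : EuclideanSpace ℝ (Fin 3)) 1) × (Metric.sphere (0 : EuclideanSpace ℝ (Fin 2)) 1) => gInv (cirT (w.2 : EuclideanSpace ℝ (Fin 2))))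
        {w : (Metric.sphere (0 : EuclideanSpace ℝ (Fin 3)) 1) × (Metric.sphere (0 : EuclideanSpace ℝ (Fin 2)) 1) | -63 / 1985 < (w.2 : EuclideanSpace ℝ (Fin 2)) 0} := by
      intro w hw
      have hw1 : (w.2 : EuclideanSpace ℝ (Fin 2)) 0 ≠ -1 := by
        intro h; simp only [mem_setOf_eq, h] at hw; norm_num at hw
      have hd : ContDiffAt ℝ ∞ (fun p : EuclideanSpace ℝ (Fin 2) => gInv (cirT p)) (w.2 : EuclideanSpace ℝ (Fin 2)) :=
        contDiff_gInv.contDiffAt.comp _ (contDiffAt_cirT hw1)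
      exact hd.contMDiffAt.comp_contMDiffWithinAt w (h2 w).contMDiffWithinAt
    exact h3.smul contMDiff_const.contMDiffOn

/-- **The neck map as a partial diffeomorphism** `Unit × ℝ¹ × S² ⇀ S² × S¹`, source the open
unit neck `{‖τ‖ < 1}` (the carrier of `ballTimesSphere Unit 0 2`), target `{w | w₂,₀ > -63/1985}`.
[cite: MilnorHCobordism1965, Def. 3.11] -/
def modelNeck : OpenPartialHomeomorph NeckAmbient ((Metric.sphere (0 : EuclideanSpace ℝ (Fin 3)) 1) × (Metric.sphere (0 : EuclideanSpace ℝ (Fin 2)) 1)) where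
  toFun := neckFun
  invFun := neckInv
  source := {b | ‖b.2.1‖ < 1}
  target := {w | -63 / 1985 < (w.2 : EuclideanSpace ℝ (Fin 2)) 0}
  map_source' _ hb := neckFun_snd_apply_zero_gt hb
  map_target' _ hw := norm_neckInv_lt hw
  left_inv' _ hb := neckInv_neckFun hb
  right_inv' _ hw := neckFun_neckInv (by intro h; simp only [mem_setOf_eq, h] at hw; norm_num at hw)
  open_source := isOpen_lt (continuous_norm.comp (continuous_fst.comp continuous_snd)) continuous_const
  open_target := isOpen_neckTarget
  continuousOn_toFun := contMDiffOn_neckFun.continuousOn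
  continuousOn_invFun := contMDiffOn_neckInv.continuousOn

/-- `modelNeck` acts as `neckFun`. [folklore] -/
@[simp] theorem modelNeck_apply (b : NeckAmbient) : modelNeck b = neckFun b := rfl

/-- The source of `modelNeck` is the open unit neck. [folklore] -/
theorem modelNeck_source : modelNeck.source = {b | ‖b.2.1‖ < 1} := rfl

/-- The target of `modelNeck`. [folklore] -/
theorem modelNeck_target : modelNeck.target = {w | -63 / 1985 < (w.2 : EuclideanSpace ℝ (Fin 2)) 0} := rfl

/-- `modelNeck` is smooth on its source. [folklore] -/
theorem contMDiffOn_modelNeck :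
    ContMDiffOn ((𝓡 0).prod ((𝓡 1).prod (𝓡 2))) ((𝓡 2).prod (𝓡 1)) ∞ modelNeck modelNeck.source :=
  contMDiffOn_neckFun

/-- `modelNeck.symm` is smooth on its target. [folklore] -/
theorem contMDiffOn_modelNeck_symm :
    ContMDiffOn ((𝓡 2).prod (𝓡 1)) ((𝓡 0).prod ((𝓡 1).prod (𝓡 2))) ∞ modelNeck.symm modelNeck.target :=
  contMDiffOn_neckInv

/-! ### §5 The gluing identities and the analysis of `H x = neck b` -/

/-- `(t • e1) 0 = t`. [folklore] -/
@[simp] theorem smul_e1_apply_zero (t : ℝ) : (t • e1) 0 = t := by simp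

/-- `(g t)⁻¹ = 1/t - t/32` for `t ≠ 0`, `t² ≠ 32`. [folklore] -/
theorem inv_gτ {t : ℝ} (ht : t ≠ 0) : (gτ t)⁻¹ = 1 / t - t / 32 := by
  rw [gτ]; field_simp

/-- `g t ≠ 0` for `t ≠ 0`, `t² < 32`. [folklore] -/
theorem gτ_ne_zero {t : ℝ} (ht : t ≠ 0) (ht2 : t ^ 2 < 32) : gτ t ≠ 0 := by
  rw [gτ]; exact div_ne_zero (mul_ne_zero (by norm_num) ht) (by linarith)

/-- **The near foot matches the positive half of the neck**: `H ((t/4) u) = neck (t e1, u)` for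
`0 < t`, `t² < 32` (Milnor's identification `φ(u, θ v) ∼ (θ u, v)` for the round ball at `0`).
[cite: MilnorHCobordism1965, Def. 3.11] -/
theorem modelHFun_near (u : (Metric.sphere (0 : EuclideanSpace ℝ (Fin 3)) 1)) {t : ℝ} (ht : 0 < t) (ht2 : t ^ 2 < 32) :
    modelHFun ((t / 4) • (u : EuclideanSpace ℝ (Fin 3))) = neckFun (DiscreteIndex.mk (), (t • e1, u)) := by
  have ht4 : 0 < t / 4 := by positivity
  refine Prod.ext ?_ ?_
  · rw [modelHFun_fst, sphereProj_smul_coe ht4]; rfl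
  · rw [modelHFun_snd, neckFun_snd, norm_smul, norm_eq_of_mem_sphere, mul_one, Real.norm_of_nonneg ht4.le,
      profB_div_four ht.ne']
    show cirP (1 / t - t / 32) = cirP' (gτ ((t • e1) 0))
    rw [smul_e1_apply_zero, cirP'_eq_cirP_inv (gτ_ne_zero ht.ne' ht2), inv_gτ ht.ne']

/-- **The far foot matches the negative half of the neck**: `H ((8/t) u) = neck (-t e1, u)` for
`0 < t`, `t² < 32` (the identification for the inverted ball at `∞`). [cite: MilnorHCobordism1965, Def. 3.11] -/
theorem modelHFun_far (u : (Metric.sphere (0 : EuclideanSpace ℝ (Fin 3)) 1)) {t : ℝ} (ht : 0 < t) (ht2 : t ^ 2 < 32) :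
    modelHFun ((8 / t) • (u : EuclideanSpace ℝ (Fin 3))) = neckFun (DiscreteIndex.mk (), ((-t) • e1, u)) := by
  have ht8 : 0 < 8 / t := by positivity
  refine Prod.ext ?_ ?_
  · rw [modelHFun_fst, sphereProj_smul_coe ht8]; rfl
  · rw [modelHFun_snd, neckFun_snd, norm_smul, norm_eq_of_mem_sphere, mul_one, Real.norm_of_nonneg ht8.le,
      profB_eight_div ht.ne']
    show cirP (t / 32 - 1 / t) = cirP' (gτ (((-t) • e1) 0))
    have hnt : -t ≠ 0 := neg_ne_zero.2 ht.ne'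
    rw [smul_e1_apply_zero, cirP'_eq_cirP_inv (gτ_ne_zero hnt (by simpa using ht2)), inv_gτ hnt]
    congr 1
    ring

/-- **Analysis of `H x = neck b`**: if `H x` (`x ≠ 0`) is a neck point `(τ e1, u)` with
`‖τ e1‖ < 1` then either `τ = t > 0` and `x = (t/4) u`, or `τ = -t < 0` and `x = (8/t) u`,
with `0 < t < 1`. [cite: MilnorHCobordism1965, Def. 3.11] -/
theorem exists_of_modelHFun_eq_neckFun {x : EuclideanSpace ℝ (Fin 3)} (hx : x ≠ 0) {b : NeckAmbient} (hb : ‖b.2.1‖ < 1)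
    (h : modelHFun x = neckFun b) :
    ∃ t : ℝ, t ∈ Ioo (0 : ℝ) 1 ∧
      ((b.2.1 = t • e1 ∧ x = (t / 4) • (b.2.2 : EuclideanSpace ℝ (Fin 3))) ∨
        (b.2.1 = (-t) • e1 ∧ x = (8 / t) • (b.2.2 : EuclideanSpace ℝ (Fin 3)))) := by
  set τ := b.2.1 0 with hτdef
  have hτ1 : |τ| < 1 := by rw [hτdef, ← norm_one_dim]; exact hb
  have hτ2 : τ ^ 2 < 32 := by have := (sq_lt_one_iff_abs_lt_one _).2 hτ1; linarith
  have hfst : sphereProj x = b.2.2 := by simpa using congrArg Prod.fst h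
  have hsnd : cirP (profB ‖x‖) = cirP' (gτ τ) := by simpa using congrArg Prod.snd h
  -- `τ ≠ 0`: otherwise the second coordinate of `H x` would be `(1, 0)`
  have hτ0 : τ ≠ 0 := by
    intro h0
    have h1 := congrArg (fun p : (Metric.sphere (0 : EuclideanSpace ℝ (Fin 2)) 1) => (p : EuclideanSpace ℝ (Fin 2)) 0) hsnd
    simp only [coe_cirP, coe_cirP', h0, gτ, mul_zero, zero_div, cirB_zero_apply_zero] at h1
    exact (cirA_apply_zero_lt_one _).ne h1
  rw [cirP'_eq_cirP_inv (gτ_ne_zero hτ0 hτ2), inv_gτ hτ0] at hsnd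
  have hB : profB ‖x‖ = 1 / τ - τ / 32 := cirP_injective hsnd
  have hxn : 0 < ‖x‖ := norm_pos_iff.2 hx
  have hbv : b.2.1 = τ • e1 := eq_smul_e1 _
  rcases lt_or_gt_of_ne hτ0 with hneg | hpos
  · -- `τ < 0`: the far foot
    refine ⟨-τ, ⟨by linarith, by linarith [(abs_lt.1 hτ1).1]⟩, Or.inr ⟨by rw [neg_neg]; exact hbv, ?_⟩⟩
    have ht : 0 < -τ := by linarith
    have hB' : profB (8 / (-τ)) = 1 / τ - τ / 32 := by
      rw [profB_eight_div ht.ne']; field_simp; ring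
    have hnorm : ‖x‖ = 8 / (-τ) := profB_injOn (mem_Ioi.2 hxn) (mem_Ioi.2 (by positivity)) (hB.trans hB'.symm)
    rw [← hfst, ← hnorm, norm_smul_coe_sphereProj hx]
  · -- `τ > 0`: the near foot
    refine ⟨τ, ⟨hpos, (abs_lt.1 hτ1).2⟩, Or.inl ⟨hbv, ?_⟩⟩
    have hB' : profB (τ / 4) = 1 / τ - τ / 32 := profB_div_four hτ0
    have hnorm : ‖x‖ = τ / 4 := profB_injOn (mem_Ioi.2 hxn) (mem_Ioi.2 (by positivity)) (hB.trans hB'.symm)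
    rw [← hfst, ← hnorm, norm_smul_coe_sphereProj hx]

/-! ### §6 The model gluing: `(S² × S¹) ∖ {H q}` is `ℝ³ ∖ {0, q}` glued to the neck -/

/-- The third point `q = (3/2, 0, 0)` of the shell between the two balls (the image of `∞` in the
`S³`-picture), at which the connected sum will be taken. [folklore] -/
def qPt : EuclideanSpace ℝ (Fin 3) := (3 / 2 : ℝ) • EuclideanSpace.single 0 1

/-- `‖q‖ = 3/2`. [folklore] -/
theorem norm_qPt : ‖qPt‖ = 3 / 2 := by
  rw [qPt, norm_smul, PiLp.norm_single, norm_one, mul_one, Real.norm_of_nonneg (by norm_num)]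

/-- `q ≠ 0`. [folklore] -/
theorem qPt_ne_zero : qPt ≠ 0 := by
  rw [← norm_pos_iff, norm_qPt]; norm_num

/-- The removed point `H q` of `S² × S¹`. [folklore] -/
def modelPoint : (Metric.sphere (0 : EuclideanSpace ℝ (Fin 3)) 1) × (Metric.sphere (0 : EuclideanSpace ℝ (Fin 2)) 1) := modelHFun qPt

/-- **The punctured model space `ℝ³ ∖ {0, q}`**, first piece of the model gluing (an open subset
of `ℝ³`). [folklore] -/
def pieceA : TopologicalSpace.Opens (EuclideanSpace ℝ (Fin 3)) :=
  ⟨{x | x ≠ 0 ∧ x ≠ qPt}, (isOpen_ne.inter isOpen_ne)⟩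

/-- Membership in `pieceA`. [folklore] -/
@[simp] theorem mem_pieceA {x : EuclideanSpace ℝ (Fin 3)} : x ∈ pieceA ↔ x ≠ 0 ∧ x ≠ qPt := Iff.rfl

/-- **The punctured `S² × S¹`**, the glued model manifold (an open subset of `S² × S¹`).
[folklore] -/
def pieceP : TopologicalSpace.Opens ((Metric.sphere (0 : EuclideanSpace ℝ (Fin 3)) 1) × (Metric.sphere (0 : EuclideanSpace ℝ (Fin 2)) 1)) := ⟨{modelPoint}ᶜ, isOpen_compl_singleton⟩

/-- Membership in `pieceP`. [folklore] -/
@[simp] theorem mem_pieceP {w : (Metric.sphere (0 : EuclideanSpace ℝ (Fin 3)) 1) × (Metric.sphere (0 : EuclideanSpace ℝ (Fin 2)) 1)} : w ∈ pieceP ↔ w ≠ modelPoint := Iff.rfl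

/-- **The model surgery relation** between `ℝ³ ∖ {0, q}` and the neck: `(t/4) u ∼ (t e1, u)` and
`(8/t) u ∼ (-t e1, u)` for `0 < t < 1`, `u ∈ S²` — Milnor's identification for the framed
`S⁰ = {0, ∞} ⊂ ℝ³ ∪ ∞` framed by the ball `t u ↦ (t/4) u` and the inverted ball `t u ↦ (8/t) u`.
[cite: MilnorHCobordism1965, Def. 3.11] -/
def modelRel (a : ↥pieceA) (b : ↥(ballTimesSphere Unit 0 2)) : Prop :=
  ∃ t : ℝ, t ∈ Ioo (0 : ℝ) 1 ∧
    (((b : NeckAmbient).2.1 = t • e1 ∧ (a : EuclideanSpace ℝ (Fin 3)) = (t / 4) • ((b : NeckAmbient).2.2 : EuclideanSpace ℝ (Fin 3))) ∨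
      ((b : NeckAmbient).2.1 = (-t) • e1 ∧ (a : EuclideanSpace ℝ (Fin 3)) = (8 / t) • ((b : NeckAmbient).2.2 : EuclideanSpace ℝ (Fin 3))))

/-- A default point of `pieceA` (the unit vector `e₀`). [folklore] -/
def ptA : ↥pieceA :=
  ⟨EuclideanSpace.single 0 1, by
    refine ⟨by simp, fun h => ?_⟩
    have := congrArg norm h
    rw [norm_qPt, PiLp.norm_single, norm_one] at this
    norm_num at this⟩

/-- A default point of the neck (the core point over `e₀`). [folklore] -/
def ptB : ↥(ballTimesSphere Unit 0 2) :=
  ⟨(DiscreteIndex.mk (), ((0 : EuclideanSpace ℝ (Fin 1)), ⟨EuclideanSpace.single 0 1, by simp⟩)), by simp⟩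

/-- `H` maps `ℝ³ ∖ {0, q}` into the punctured `S² × S¹`. [folklore] -/
theorem mapsTo_modelH : MapsTo modelH (pieceA : Set (EuclideanSpace ℝ (Fin 3))) (pieceP : Set ((Metric.sphere (0 : EuclideanSpace ℝ (Fin 3)) 1) × (Metric.sphere (0 : EuclideanSpace ℝ (Fin 2)) 1))) := by
  intro x hx h
  have hinj := modelH.injOn (show x ∈ modelH.source from hx.1) (show qPt ∈ modelH.source from qPt_ne_zero)
  exact hx.2 (hinj h)

/-- The neck misses the removed point `H q`. [folklore] -/
theorem mapsTo_modelNeck :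
    MapsTo modelNeck ((ballTimesSphere Unit 0 2 : TopologicalSpace.Opens NeckAmbient) : Set NeckAmbient)
      (pieceP : Set ((Metric.sphere (0 : EuclideanSpace ℝ (Fin 3)) 1) × (Metric.sphere (0 : EuclideanSpace ℝ (Fin 2)) 1))) := by
  intro b hb h
  have hb' : ‖b.2.1‖ < 1 := hb
  obtain ⟨t, ht, hcase⟩ := exists_of_modelHFun_eq_neckFun qPt_ne_zero hb' (Eq.symm h)
  rcases hcase with ⟨-, hq⟩ | ⟨-, hq⟩
  · have := congrArg norm hq
    rw [norm_qPt, norm_smul, norm_eq_of_mem_sphere, mul_one, Real.norm_of_nonneg (by linarith [ht.1])] at this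
    linarith [ht.2]
  · have := congrArg norm hq
    rw [norm_qPt, norm_smul, norm_eq_of_mem_sphere, mul_one, Real.norm_of_nonneg (by
      have := ht.1; positivity)] at this
    have h8 : (8 : ℝ) < 8 / t := by rw [lt_div_iff₀ ht.1]; nlinarith [ht.2]
    linarith

/-- `pieceA ⊆ modelH.source`. [folklore] -/
theorem pieceA_subset_source : (pieceA : Set (EuclideanSpace ℝ (Fin 3))) ⊆ modelH.source := fun _ hx => hx.1

/-- The carrier of the neck is the source of `modelNeck`. [folklore] -/
theorem ballTimesSphere_subset_source :
    ((ballTimesSphere Unit 0 2 : TopologicalSpace.Opens NeckAmbient) : Set NeckAmbient) ⊆ modelNeck.source :=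
  fun _ hb => hb

/-- **The first gluing map** `ℝ³ ∖ {0, q} → (S² × S¹) ∖ {H q}`, `x ↦ H x`. [folklore] -/
def glueA : ↥pieceA → ↥pieceP := modelH.subtypeLift pieceA pieceP ptA pieceA_subset_source mapsTo_modelH

/-- **The second gluing map** `(-1, 1) × S² → (S² × S¹) ∖ {H q}`, the neck. [folklore] -/
def glueB : ↥(ballTimesSphere Unit 0 2) → ↥pieceP :=
  modelNeck.subtypeLift (ballTimesSphere Unit 0 2) pieceP ptB ballTimesSphere_subset_source mapsTo_modelNeck

/-- `glueA` acts as `H`. [folklore] -/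
@[simp] theorem coe_glueA (a : ↥pieceA) : (glueA a : (Metric.sphere (0 : EuclideanSpace ℝ (Fin 3)) 1) × (Metric.sphere (0 : EuclideanSpace ℝ (Fin 2)) 1)) = modelHFun a := rfl

/-- `glueB` acts as the neck map. [folklore] -/
@[simp] theorem coe_glueB (b : ↥(ballTimesSphere Unit 0 2)) : (glueB b : (Metric.sphere (0 : EuclideanSpace ℝ (Fin 3)) 1) × (Metric.sphere (0 : EuclideanSpace ℝ (Fin 2)) 1)) = neckFun b := rfl

/-- `glueA` is a smooth embedding. [folklore] -/
theorem isSmoothEmbedding_glueA : Manifold.IsSmoothEmbedding (𝓡 3) ((𝓡 2).prod (𝓡 1)) ∞ glueA :=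
  isSmoothEmbedding_of_openPartialHomeomorph _ (OpenPartialHomeomorph.subtypeLift_source _ _ _)
    (OpenPartialHomeomorph.contMDiffOn_subtypeLift _ _ _ contMDiffOn_modelH)
    (OpenPartialHomeomorph.contMDiffOn_subtypeLift_symm _ _ _ contMDiffOn_modelH_symm)
    (ContinuousLinearEquiv.ofFinrankEq (by simp))

/-- `glueB` is a smooth embedding. [folklore] -/
theorem isSmoothEmbedding_glueB :
    Manifold.IsSmoothEmbedding ((𝓡 0).prod ((𝓡 1).prod (𝓡 2))) ((𝓡 2).prod (𝓡 1)) ∞ glueB :=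
  isSmoothEmbedding_of_openPartialHomeomorph _ (OpenPartialHomeomorph.subtypeLift_source _ _ _)
    (OpenPartialHomeomorph.contMDiffOn_subtypeLift _ _ _ contMDiffOn_modelNeck)
    (OpenPartialHomeomorph.contMDiffOn_subtypeLift_symm _ _ _ contMDiffOn_modelNeck_symm)
    (ContinuousLinearEquiv.ofFinrankEq (by simp))

/-- The range of `glueA` is open. [folklore] -/
theorem isOpen_range_glueA : IsOpen (range glueA) := by
  rw [glueA, OpenPartialHomeomorph.range_subtypeLift]; exact OpenPartialHomeomorph.open_target _

/-- The range of `glueB` is open. [folklore] -/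
theorem isOpen_range_glueB : IsOpen (range glueB) := by
  rw [glueB, OpenPartialHomeomorph.range_subtypeLift]; exact OpenPartialHomeomorph.open_target _

/-- A point of the circle with first coordinate `1` is `P' 0 = (1, 0)`. [folklore] -/
theorem eq_cirP'_zero_of_apply_zero_eq_one {p : (Metric.sphere (0 : EuclideanSpace ℝ (Fin 2)) 1)} (hp : (p : EuclideanSpace ℝ (Fin 2)) 0 = 1) : p = cirP' 0 := by
  have h1 : (p : EuclideanSpace ℝ (Fin 2)) 0 ^ 2 + (p : EuclideanSpace ℝ (Fin 2)) 1 ^ 2 = 1 := by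
    rw [← StdCircleSurgery.norm_sq_two, norm_eq_of_mem_sphere p, one_pow]
  have hp1 : (p : EuclideanSpace ℝ (Fin 2)) 1 = 0 := by nlinarith
  apply Subtype.ext
  ext i
  fin_cases i
  · simpa using hp
  · simpa using hp1

/-- **The two gluing maps cover the punctured `S² × S¹`.** [folklore] -/
theorem range_glueA_union_range_glueB : range glueA ∪ range glueB = univ := by
  refine eq_univ_of_forall fun p => ?_
  by_cases hw : ((p : (Metric.sphere (0 : EuclideanSpace ℝ (Fin 3)) 1) × (Metric.sphere (0 : EuclideanSpace ℝ (Fin 2)) 1)).2 : EuclideanSpace ℝ (Fin 2)) 0 ≠ 1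
  · -- off the pole: in the image of `H`
    left
    set x := modelHInv (p : (Metric.sphere (0 : EuclideanSpace ℝ (Fin 3)) 1) × (Metric.sphere (0 : EuclideanSpace ℝ (Fin 2)) 1)) with hxdef
    have hx0 : x ≠ 0 := modelHInv_ne_zero _
    have hHx : modelHFun x = p := modelHFun_modelHInv hw
    have hxq : x ≠ qPt := by
      intro h
      exact p.2 (by rw [mem_singleton_iff, ← hHx, h]; rfl)
    exact ⟨⟨x, hx0, hxq⟩, Subtype.ext hHx⟩
  · -- on the pole: the core sphere of the neck
    right
    rw [not_not] at hw
    refine ⟨⟨(DiscreteIndex.mk (), ((0 : EuclideanSpace ℝ (Fin 1)), (p : (Metric.sphere (0 : EuclideanSpace ℝ (Fin 3)) 1) × (Metric.sphere (0 : EuclideanSpace ℝ (Fin 2)) 1)).1)), by simp⟩, Subtype.ext ?_⟩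
    rw [coe_glueB]
    refine Prod.ext rfl ?_
    rw [neckFun_snd, eq_cirP'_zero_of_apply_zero_eq_one hw]
    simp [gτ]

/-- **`glueA a = glueB b` iff `modelRel a b`.** [cite: MilnorHCobordism1965, Def. 3.11] -/
theorem glueA_eq_glueB_iff (a : ↥pieceA) (b : ↥(ballTimesSphere Unit 0 2)) :
    glueA a = glueB b ↔ modelRel a b := by
  rw [← Subtype.coe_inj, coe_glueA, coe_glueB]
  have hb : ‖(b : NeckAmbient).2.1‖ < 1 := b.2
  constructor
  · intro h
    exact exists_of_modelHFun_eq_neckFun a.2.1 hb h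
  · rintro ⟨t, ht, ⟨hv, ha⟩ | ⟨hv, ha⟩⟩
    · have ht2 : t ^ 2 < 32 := by nlinarith [ht.1, ht.2]
      obtain ⟨⟨i, v, u⟩, hb'⟩ := b
      simp only at hv ha ⊢
      rw [ha, modelHFun_near u ht.1 ht2, hv]
      rfl
    · have ht2 : t ^ 2 < 32 := by nlinarith [ht.1, ht.2]
      obtain ⟨⟨i, v, u⟩, hb'⟩ := b
      simp only at hv ha ⊢
      rw [ha, modelHFun_far u ht.1 ht2, hv]
      rfl

/-- **The model gluing, with its maps**: the punctured `S² × S¹` is the open gluing of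
`ℝ³ ∖ {0, q}` and the neck `(-1, 1) × S²` along `modelRel`, by the maps `glueA = H` and
`glueB = neck` ("`S² × S¹` minus a point is the `0`-surgery of `ℝ³ ∪ ∞` along the framed
`S⁰ = {0, ∞}`"; Milnor 1965, Def. 3.11; Kosinski 1993, VI §9). [cite: MilnorHCobordism1965, Def. 3.11] -/
theorem isOpenGluingWith_model :
    IsOpenGluingWith (𝓡 3) ((𝓡 0).prod ((𝓡 1).prod (𝓡 2))) ((𝓡 2).prod (𝓡 1))
      (A := ↥pieceA) (B := ↥(ballTimesSphere Unit 0 2)) (P := ↥pieceP) modelRel glueA glueB :=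
  ⟨isSmoothEmbedding_glueA, isOpen_range_glueA, isSmoothEmbedding_glueB, isOpen_range_glueB,
    range_glueA_union_range_glueB, glueA_eq_glueB_iff⟩

/-- **The model gluing**: `(S² × S¹) ∖ {H q}` is an open gluing (`IsOpenGluing`) of `ℝ³ ∖ {0, q}`
and the neck along `modelRel`. [cite: MilnorHCobordism1965, Def. 3.11] -/
theorem isOpenGluing_model :
    IsOpenGluing (𝓡 3) ((𝓡 0).prod ((𝓡 1).prod (𝓡 2))) ((𝓡 2).prod (𝓡 1))
      (A := ↥pieceA) (B := ↥(ballTimesSphere Unit 0 2)) (P := ↥pieceP) modelRel :=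
  isOpenGluingWith_model.isOpenGluing

/-! ### §7 The Möbius inversion `N` centred at `q`, and its inverse `M`

In the `S³ = ℝ³ ∪ ∞` picture the chart ball of the `3`-manifold is blown up to a copy `ℝ³_z`
of `ℝ³` whose point at infinity is the connected-sum point; the Möbius map `M z = q + z/‖z‖²`
carries `(ℝ³_z ∪ ∞; f₊ = -q/‖q‖², f₋ = 0, ∞)` to `(ℝ³ ∪ ∞; 0, ∞, q)`, the configuration of the
model above.  `N` is its inverse `x ↦ (x - q)/‖x - q‖²`. -/

/-- The Möbius inversion `N x = (x - q)/‖x - q‖²` centred at `q` (so `N q = ∞`, `N ∞ = 0`,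
`N 0 = -q/‖q‖²`); junk value `0` at `x = q`. [folklore] -/
def mobN (x : EuclideanSpace ℝ (Fin 3)) : EuclideanSpace ℝ (Fin 3) := (‖x - qPt‖ ^ 2)⁻¹ • (x - qPt)

/-- Its inverse `M z = q + z/‖z‖²` (junk value `q` at `z = 0`). [folklore] -/
def mobM (z : EuclideanSpace ℝ (Fin 3)) : EuclideanSpace ℝ (Fin 3) := qPt + (‖z‖ ^ 2)⁻¹ • z

/-- The near foot in blown-up coordinates, `f₊ = N 0 = -q/‖q‖² = -(4/9) q`. [folklore] -/
def nearFootZ : EuclideanSpace ℝ (Fin 3) := mobN 0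

/-- `‖N x‖ = ‖x - q‖⁻¹`. [folklore] -/
theorem norm_mobN (x : EuclideanSpace ℝ (Fin 3)) : ‖mobN x‖ = ‖x - qPt‖⁻¹ := by
  by_cases hx : x - qPt = 0
  · simp [mobN, hx]
  · rw [mobN, norm_smul, norm_inv, norm_pow, norm_norm, pow_two, mul_inv, mul_assoc,
      inv_mul_cancel₀ (norm_ne_zero_iff.2 hx), mul_one]

/-- `‖M z - q‖ = ‖z‖⁻¹`. [folklore] -/
theorem norm_mobM_sub (z : EuclideanSpace ℝ (Fin 3)) : ‖mobM z - qPt‖ = ‖z‖⁻¹ := by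
  by_cases hz : z = 0
  · simp [mobM, hz]
  · rw [mobM, add_sub_cancel_left, norm_smul, norm_inv, norm_pow, norm_norm, pow_two, mul_inv, mul_assoc,
      inv_mul_cancel₀ (norm_ne_zero_iff.2 hz), mul_one]

/-- `M (N x) = x` for `x ≠ q`. [folklore] -/
theorem mobM_mobN {x : EuclideanSpace ℝ (Fin 3)} (hx : x ≠ qPt) : mobM (mobN x) = x := by
  have hne : x - qPt ≠ 0 := sub_ne_zero.2 hx
  have hn : ‖x - qPt‖ ^ 2 ≠ 0 := pow_ne_zero 2 (norm_ne_zero_iff.2 hne)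
  rw [mobM, norm_mobN, inv_pow, inv_inv, mobN, smul_smul, mul_inv_cancel₀ hn, one_smul, add_sub_cancel]

/-- `N (M z) = z` for `z ≠ 0`. [folklore] -/
theorem mobN_mobM {z : EuclideanSpace ℝ (Fin 3)} (hz : z ≠ 0) : mobN (mobM z) = z := by
  have hn : ‖z‖ ^ 2 ≠ 0 := pow_ne_zero 2 (norm_ne_zero_iff.2 hz)
  rw [mobN, norm_mobM_sub, inv_pow, inv_inv, mobM, add_sub_cancel_left, smul_smul, mul_inv_cancel₀ hn, one_smul]

/-- `M z = q` only for `z = 0` (the junk value). [folklore] -/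
theorem mobM_ne_qPt {z : EuclideanSpace ℝ (Fin 3)} (hz : z ≠ 0) : mobM z ≠ qPt := by
  intro h
  have := norm_mobM_sub z
  rw [h, sub_self, norm_zero] at this
  exact hz (norm_eq_zero.1 (inv_eq_zero.1 this.symm))

/-- `N x = 0` only for `x = q` (the junk value). [folklore] -/
theorem mobN_ne_zero {x : EuclideanSpace ℝ (Fin 3)} (hx : x ≠ qPt) : mobN x ≠ 0 := by
  intro h
  have := norm_mobN x
  rw [h, norm_zero] at this
  exact sub_ne_zero.2 hx (norm_eq_zero.1 (inv_eq_zero.1 this.symm))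

/-- `N 0 = -(4/9) q`. [folklore] -/
theorem nearFootZ_eq : nearFootZ = (-(4 / 9) : ℝ) • qPt := by
  rw [nearFootZ, mobN, zero_sub, norm_neg, norm_qPt, smul_neg, ← neg_smul]
  norm_num

/-- `N 0 ≠ 0`. [folklore] -/
theorem nearFootZ_ne_zero : nearFootZ ≠ 0 := by
  rw [nearFootZ_eq]; exact smul_ne_zero (by norm_num) qPt_ne_zero

/-- `M (N 0) = 0`: `M` sends the near foot to the origin. [folklore] -/
theorem mobM_nearFootZ : mobM nearFootZ = 0 := mobM_mobN (Ne.symm qPt_ne_zero)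

/-- `M z = 0` only for `z = N 0`. [folklore] -/
theorem mobM_eq_zero_iff {z : EuclideanSpace ℝ (Fin 3)} (hz : z ≠ 0) : mobM z = 0 ↔ z = nearFootZ := by
  constructor
  · intro h
    rw [← mobN_mobM hz, h, nearFootZ]
  · rintro rfl; exact mobM_nearFootZ

/-- `N` is smooth off `q`. [folklore] -/
theorem contDiffAt_mobN {x : EuclideanSpace ℝ (Fin 3)} (hx : x ≠ qPt) : ContDiffAt ℝ ∞ mobN x := by
  have hne : x - qPt ≠ 0 := sub_ne_zero.2 hx
  have h1 : ContDiffAt ℝ ∞ (fun x : EuclideanSpace ℝ (Fin 3) => ‖x - qPt‖ ^ 2) x :=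
    (contDiff_norm_sq ℝ).contDiffAt.comp x (contDiffAt_id.sub contDiffAt_const)
  exact (h1.inv (pow_ne_zero 2 (norm_ne_zero_iff.2 hne))).smul (contDiffAt_id.sub contDiffAt_const)

/-- `M` is smooth off `0`. [folklore] -/
theorem contDiffAt_mobM {z : EuclideanSpace ℝ (Fin 3)} (hz : z ≠ 0) : ContDiffAt ℝ ∞ mobM z := by
  have h1 : ContDiffAt ℝ ∞ (fun z : EuclideanSpace ℝ (Fin 3) => ‖z‖ ^ 2) z := (contDiff_norm_sq ℝ).contDiffAt
  exact contDiffAt_const.add ((h1.inv (pow_ne_zero 2 (norm_ne_zero_iff.2 hz))).smul contDiffAt_id)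

/-! ### §8 The blow-up `β̂ : B(0, 1/8) ≅ ℝ³` of the chart ball

A radial diffeomorphism of the open ball of radius `1/8` onto `ℝ³`, linear (`= 8 • id`) on the
ball of radius `1/32` and equal to `y ↦ 8 y/(1 - 8‖y‖)` on the shell `1/22 ≤ ‖y‖ < 1/8` (so that
the shell `1/12 < ‖y‖ < 1/8` — the negative half of the neck — is blown up onto `‖z‖ > 2`, and a
point at chart radius `8/(64 + t)` to blown-up radius `64/t`). -/

/-- The cut-off of the blow-up profile: `0` for `s ≤ 1/32`, `1` for `s ≥ 1/22`. [folklore] -/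
def blowCut (s : ℝ) : ℝ := Real.smoothTransition ((352 * s - 11) / 5)

/-- **The blow-up profile** `b̂ s = 8 s + χ̂ s · 64 s²/(1 - 8 s)`: `8 s` near `0`, `8 s/(1 - 8 s)` on
`[1/22, 1/8)`, strictly increasing from `0` to `∞` on `[0, 1/8)`. [folklore] -/
def blowProfile (s : ℝ) : ℝ := 8 * s + blowCut s * (64 * s ^ 2 / (1 - 8 * s))

/-- The inverse blow-up profile (the inverse of `b̂` on `[0, 1/8)`). [folklore] -/
def blowProfileInv : ℝ → ℝ := invFunOn blowProfile (Ico 0 (1 / 8))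

/-- **The blow-up** `β̂ = radialMap b̂ : B(0, 1/8) → ℝ³`. [folklore] -/
def blowUp : EuclideanSpace ℝ (Fin 3) → EuclideanSpace ℝ (Fin 3) := radialMap blowProfile

/-- **The blow-down** `β̂⁻¹ = radialMap b̂⁻¹ : ℝ³ → B(0, 1/8)`. [folklore] -/
def blowDown : EuclideanSpace ℝ (Fin 3) → EuclideanSpace ℝ (Fin 3) := radialMap blowProfileInv

/-- `χ̂ s = 0` for `s ≤ 1/32`. [folklore] -/
theorem blowCut_of_le {s : ℝ} (h : s ≤ 1 / 32) : blowCut s = 0 :=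
  Real.smoothTransition.zero_of_nonpos (by
    rw [div_nonpos_iff]; right; constructor <;> linarith)

/-- `χ̂ s = 1` for `1/22 ≤ s`. [folklore] -/
theorem blowCut_of_ge {s : ℝ} (h : 1 / 22 ≤ s) : blowCut s = 1 :=
  Real.smoothTransition.one_of_one_le (by linarith)

/-- `b̂ s = 8 s` for `s ≤ 1/32`. [folklore] -/
theorem blowProfile_of_le {s : ℝ} (h : s ≤ 1 / 32) : blowProfile s = 8 * s := by
  rw [blowProfile, blowCut_of_le h, zero_mul, add_zero]

/-- `b̂ s = 8 s/(1 - 8 s)` for `1/22 ≤ s`, `s ≠ 1/8`. [folklore] -/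
theorem blowProfile_of_ge {s : ℝ} (h : 1 / 22 ≤ s) (h' : s ≠ 1 / 8) : blowProfile s = 8 * s / (1 - 8 * s) := by
  have hne : 1 - 8 * s ≠ 0 := by intro h0; apply h'; linarith
  rw [blowProfile, blowCut_of_ge h, one_mul]
  field_simp
  ring

/-! ### §9 The standard discs in chart coordinates

The two framing discs of the model, read in the chart ball of the `3`-manifold
(coordinates `y`, before blow-up): `D₊ = β̂⁻¹ ∘ N ∘ (x ↦ x/4 on the unit ball)` (the round ball at
`0` of the `S³`-model) and `D₋ = β̂⁻¹ ∘ (N ∘ inv₈)`, `inv₈ w = 8 w/‖w‖²` (the inverted ball at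
`∞`), both pre-composed with a radial compression `x ↦ 4 g(8 x)` of `ℝ³` onto `B(0, 4)` equal to
the identity on the closed unit ball, so that they are total smooth embeddings of `ℝ³`. -/

/-- The radial compression `x ↦ 4 g(8 x)` of `ℝ³` onto `B(0, 4)` (`g` the tree's ball contraction),
the identity on the closed unit ball. [folklore] -/
def fourBall (x : EuclideanSpace ℝ (Fin 3)) : EuclideanSpace ℝ (Fin 3) := (4 : ℝ) • ballContraction ((8 : ℝ) • x)

/-- The Möbius map `N ∘ inv₈` in closed form: `w ↦ (8 w - ‖w‖² q)/(64 - 16 ⟪w, q⟫ + ‖q‖² ‖w‖²)`,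
smooth on `B(0, 16/3)`, with value `0` and derivative `id/8` at `0`. [folklore] -/
def farMob (w : EuclideanSpace ℝ (Fin 3)) : EuclideanSpace ℝ (Fin 3) :=
  (64 - 16 * inner ℝ w qPt + ‖qPt‖ ^ 2 * ‖w‖ ^ 2)⁻¹ • ((8 : ℝ) • w - ‖w‖ ^ 2 • qPt)

/-- **The near standard disc** `D₊ = β̂⁻¹ ∘ N ∘ (x ↦ fourBall x / 4)`, in chart coordinates.
[cite: Kosinski1993, VI §9] -/
def discNear (x : EuclideanSpace ℝ (Fin 3)) : EuclideanSpace ℝ (Fin 3) :=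
  blowDown (mobN ((4 : ℝ)⁻¹ • fourBall x))

/-- **The far standard disc** `D₋ = β̂⁻¹ ∘ (N ∘ inv₈) ∘ fourBall`, in chart coordinates.
[cite: Kosinski1993, VI §9] -/
def discFar (x : EuclideanSpace ℝ (Fin 3)) : EuclideanSpace ℝ (Fin 3) := blowDown (farMob (fourBall x))

/-- The centre of the near disc in chart coordinates, `β̂⁻¹ (N 0)`. [folklore] -/
def nearCentre : EuclideanSpace ℝ (Fin 3) := blowDown nearFootZ

/-! ### §10 The neck profile of the assembly -/

/-- The odd extension `ω` of the tree's ball profile: a smooth strictly increasing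
diffeomorphism `ℝ ≅ (-1, 1)`, `ω t = t/32` on `[-8, 8]`. [folklore] -/
def omegaProfile (t : ℝ) : ℝ := if 0 ≤ t then ballProfile t else -ballProfile (-t)

/-- **The radius profile of the separating neck**, `Λ t = 1/(4 (2 - ω t))`: chart radius of the
neck point of parameter `t`; increasing from `1/12` (`t → -∞`) through `1/8` (`t = 0`, the middle
sphere) to `1/4` (`t → +∞`); `Λ t = punctureProfile (ballProfile t / 2)` for `t ≥ 0`. [folklore] -/
def lamProfile (t : ℝ) : ℝ := 1 / (4 * (2 - omegaProfile t))

/-! ### §11 Milnor's relation for two prescribed discs -/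

/-- **Milnor's `0`-surgery identification for two discs `D₊`, `D₋ : ℝ³ → Z`** (feet
`D₊ 0`, `D₋ 0`): the point `a` of `Z` off the feet is identified with the neck point
`(τ e1, u)` iff `τ = t ∈ (0, 1)` and `a = D₊ (t u)`, or `τ = -t` and `a = D₋ (t u)` — the relation
`sphereFamilySurgeryRel` of the framed `S⁰` whose two unit tubes are `D₊`, `D₋`.
[cite: MilnorHCobordism1965, Def. 3.11] -/
def stdRel {Z : Type*} (Dp Dm : EuclideanSpace ℝ (Fin 3) → Z) {A : Set Z} (a : ↥A)
    (b : ↥(ballTimesSphere Unit 0 2)) : Prop :=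
  ∃ t : ℝ, t ∈ Ioo (0 : ℝ) 1 ∧
    (((b : NeckAmbient).2.1 = t • e1 ∧ (a : Z) = Dp (t • ((b : NeckAmbient).2.2 : EuclideanSpace ℝ (Fin 3)))) ∨
      ((b : NeckAmbient).2.1 = (-t) • e1 ∧ (a : Z) = Dm (t • ((b : NeckAmbient).2.2 : EuclideanSpace ℝ (Fin 3)))))

/-- **The model map on the blown-up chart ball**: `K y = H (M (β̂ y))`, defined off
`{0, β̂⁻¹ (N 0)}` inside `B(0, 1/8)`; it identifies the chart ball, surgered along the two
standard discs, with the punctured `S² × S¹`. [cite: Kosinski1993, VI §9] -/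
def modelK (y : EuclideanSpace ℝ (Fin 3)) :
    (Metric.sphere (0 : EuclideanSpace ℝ (Fin 3)) 1) × (Metric.sphere (0 : EuclideanSpace ℝ (Fin 2)) 1) :=
  modelHFun (mobM (blowUp y))

/-- **The connected-sum disc of `S² × S¹`**: `c₂ y = H (q + g y/2)` (`g` the tree's ball
contraction), a smooth embedding of `ℝ³` centred at the removed point `H q`; along the neck of the
assembly `c₂ (t θ) = K (Λ (-t) θ)`. [folklore] -/
def discC2 (y : EuclideanSpace ℝ (Fin 3)) :
    (Metric.sphere (0 : EuclideanSpace ℝ (Fin 3)) 1) × (Metric.sphere (0 : EuclideanSpace ℝ (Fin 2)) 1) :=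
  modelHFun (qPt + (2 : ℝ)⁻¹ • ballContraction y)

/-- The blown-up chart ball minus the two feet `{0, N 0}` (coordinates `z`), an open subset
of `ℝ³`. [folklore] -/
def blowPieceZ : TopologicalSpace.Opens (EuclideanSpace ℝ (Fin 3)) :=
  ⟨{z | z ≠ 0 ∧ z ≠ nearFootZ}, isOpen_ne.inter isOpen_ne⟩

/-- Membership in `blowPieceZ`. [folklore] -/
@[simp] theorem mem_blowPieceZ {z : EuclideanSpace ℝ (Fin 3)} : z ∈ blowPieceZ ↔ z ≠ 0 ∧ z ≠ nearFootZ := Iff.rfl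

/-- The chart ball `B(0, 1/8)` minus the two disc centres `{0, β̂⁻¹ (N 0)}` (coordinates `y`),
an open subset of `ℝ³`. [folklore] -/
def chartPieceY : TopologicalSpace.Opens (EuclideanSpace ℝ (Fin 3)) :=
  ⟨{y | ‖y‖ < 1 / 8 ∧ y ≠ 0 ∧ y ≠ nearCentre},
    (isOpen_lt continuous_norm continuous_const).inter (isOpen_ne.inter isOpen_ne)⟩

/-- Membership in `chartPieceY`. [folklore] -/
@[simp] theorem mem_chartPieceY {y : EuclideanSpace ℝ (Fin 3)} :
    y ∈ chartPieceY ↔ ‖y‖ < 1 / 8 ∧ y ≠ 0 ∧ y ≠ nearCentre := Iff.rfl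

end ZeroSphereModel

end Literature.Topology.FourManifolds
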